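import Summits.BirchSwinnertonDyer.BirchSwinnertonDyer.Theses.KatoDescentPotSupersingular
import Summits.BirchSwinnertonDyer.BirchSwinnertonDyer.Theorems.KatoDescentPotSupersingularWildUpperOptimalSharpNodesJ08S2b
import Summits.BirchSwinnertonDyer.BirchSwinnertonDyer.Theorems.KatoDescentPotSupersingularWildJetchevBoundAtPTwoSplit
import Summits.BirchSwinnertonDyer.BirchSwinnertonDyer.Theorems.KatoDescentTamePotSupersingularJetchevIrreducibleReadingTwoSplit
import Summits.BirchSwinnertonDyer.BirchSwinnertonDyer.Theorems.KatoDescentPotSupersingularWildUpperDefectOfSplit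
import HarnessLib

/-!
# Route `KatoDescentPotSupersingular` (rung K9, wild `3`, cell `bsd-potss`): the split child `WildJetchevBoundAtPTwoSplit` (item 21422),
# the U₀-ns node `WildUpperNonsurjTower` (item 19189) and the U₀ parent `WildUpperDefectRankZero` (item 19197) BY NAME, with NO Heegner crux among the hypotheses — from FOUR NAMED LITERATURE
# FACTS {Matar–Nekovář 2019 Thm 0.7, Gross 1991 Prop 3.7 (2), Poitou–Tate for the tree's Selmer structures, [GZ86 III (3.1)] image-free},
# the route's held inputs, and the route's OTHER items (Conj-A residue, L₀, the residual `WildRankOne`, the reducible branch)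

Cell `bsd-potss`, seat `bsd-potss-k9-c4` g11 (prover); `--supports stmt-BirchSwinnertonDyer-19197`, helper (imports the K9 route file for the decl
names). CONDITIONAL on the displayed named facts (no `_holds` in the tree for any of the four) and on the route items displayed as hypotheses;
closes NOTHING (conditional-result); nothing booked; BSD is not proved for any curve.

WHAT. The J08 glue (item 20173) derives `WildUpperNonsurjTower` from the two Heegner readings `JetchevIrreducibleReadingByName` (20165, the
Jetchev irreducible reading BY NAME) and `WildJetchevBoundAtP` (19941). Both are applied by the road ONLY at its Bump–Friedberg–Hoffstein field,
chosen with `2` split (`hBFH W hw {2} 4`). This seat's two-split forms of the two readings (`JetchevIrreducibleSwapAtP.cor15_irreducibleReadingTwoSplit_of_namedFacts`,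
`…wildJetchevBoundAtPTwoSplit_of_namedFacts`: the bodies with ONE extra binder `SatisfiesHeegnerHypothesis 2 K`) are THEOREMS modulo the four
named facts + `PublishedInputsHeegner` (Kolyvagin's prime-swap walk on an irreducible row — k8t-c4 g12 — has its `ℓ₀ = 2` guard void when `2`
splits), and the road/nodes re-issue `WildUpperOptimalSharpNodesJ08S2b.…` (p563930/p564462) consumes exactly those forms. Composing:
* `wildUpperNonsurjTower_of_fourNamedFacts` — the decl of item 19189 BY NAME from the four facts + `PublishedInputsHeegner` +
  `PublishedInputCasselsIsogenyRed` + `WildCoatesSujathaResidue` (19942) + `WildLowerHalfRankZero` (19195) + `WildRankOne` (19200, residual) +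
  `KatoTamagawaExactInputs` + `PublishedInputsFineSelmerCM` (binder order of glue 20173 with `hJ`, `hJp` replaced by the four facts);
* `wildUpperDefectRankZero_of_fourNamedFacts` — the decl of item 19197 BY NAME, adding the reducible branch `WildUpperReducibleDefect` (19190)
  through the closed glue `wildUpperDefectOfSplit_proof` (19192).
So the K9 cone's Heegner line reads: {four named facts} ∧ held inputs ∧ {19942, 19195, 19200, 19190} ⊢ 19189 ∧ 19197 — the cruxes 19941 / 20165
are no longer needed by K9 once the planner re-keys glue 20173 (FINDING memo `HOME/k9-c4/g11/FINDING-19941-20165-twoSplit-swapGuard-k9c4g11.md` §3).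

References (locators only; cited FACTS enter as hypotheses, never declared): [cite: MatarNekovar2019, Thm. 0.7 (p. 456), §0.11]
[cite: GrossLMS1991, Prop. 3.7 (2), §6 p. 245] [cite: GrossZagier1986, III (3.1)] [cite: MilneADT2006, Ch. I, Thm. 4.10]
[cite: Jetchev2008, Thm. 1.4, Cor. 1.5 (p. 812)] [cite: BumpFriedbergHoffstein1990, Theorem (pp. 543–544)] [cite: Kato2004Asterisque, Thm. 14.5 (3)]
[cite: CoatesSujatha2005, Conj. A]. Design: theorems only. Axioms: `propext`, `Classical.choice`, `Quot.sound`.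
-/

set_option autoImplicit false
-- the Theorems directory repeats the summit name (sibling precedent `KatoDescentPotSupersingularAssembly.lean`)
set_option linter.dupNamespace false

noncomputable section

open scoped Classical

open WeierstrassCurve Literature.NumberTheory.EllipticCurves Literature.NumberTheory.EllipticCurves.ModularForms
  Literature.NumberTheory.EllipticCurves.Rank1Residual Literature.NumberTheory.GaloisCohomology
  Summit.BirchSwinnertonDyer.BirchSwinnertonDyer.Theses.KatoDescentPotSupersingular

namespace Summit.BirchSwinnertonDyer.BirchSwinnertonDyer.Theorems.JetchevIrreducibleSwapAtP

/-- **The split child 21422 `WildJetchevBoundAtPTwoSplit` (crux 19941 at Heegner fields with `2` split) BY NAME, from FOUR NAMED LITERATURE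
FACTS and the route's held `PublishedInputsHeegner`** — this seat's `wildJetchevBoundAtPTwoSplit_of_namedFacts` (p564034) with the route decl as
its conclusion (the decl's body is that theorem's statement verbatim). CONDITIONAL on the four facts (none has a `_holds`); closes NOTHING by
itself; BSD is not proved for any curve. [cite: MatarNekovar2019, Thm. 0.7 (p. 456), §0.11] [cite: GrossLMS1991, Prop. 3.7 (2)]
[cite: GrossZagier1986, III (3.1)] [cite: MilneADT2006, Ch. I, Thm. 4.10] [cite: Jetchev2008, Cor. 1.5 (p. 812)] -/
theorem wildJetchevBoundAtPTwoSplit_byName_of_fourNamedFacts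
    (hS1 : MatarNekovar2019.thm07_padicValNat_card_sha_primary_add_le_of_globalDivisibility_of_irreducible)
    (h37 : GrossLMS1991.prop37_2_frobeniusCongruence)
    (hPT : ∀ (K : Type) [Field K] [NumberField K], poitouTate_selmerStructure_duality_conj K)
    (hF1 : Gross1991_heegnerPoint_sub_ratTorsion_mem_E0_imageFree)
    (hH : PublishedInputsHeegner) : WildJetchevBoundAtPTwoSplit := by
  unfold WildJetchevBoundAtPTwoSplit
  exact wildJetchevBoundAtPTwoSplit_of_namedFacts hS1 h37 hPT hF1 hH

/-- **The K9 U₀-ns node `WildUpperNonsurjTower` (item 19189) BY NAME with NO Heegner crux**: from the four named Literature facts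
{`MatarNekovar2019.thm07_…` (S1), `GrossLMS1991.prop37_2_frobeniusCongruence`, `poitouTate_selmerStructure_duality_conj` (∀ K),
`Gross1991_heegnerPoint_sub_ratTorsion_mem_E0_imageFree`}, the route's held `PublishedInputsHeegner` (19914) / `PublishedInputCasselsIsogenyRed` /
`KatoTamagawaExactInputs` (19191) / `PublishedInputsFineSelmerCM` (19387), the Conj-A residue crux `WildCoatesSujathaResidue` (19942), L₀
`WildLowerHalfRankZero` (19195) and the residual `WildRankOne` (19200). = glue 20173's binder list with the two Heegner readings replaced by
the four facts (kernel `WildUpperOptimalSharpNodesJ08S2b.…` ∘ the two-split readings). CONDITIONAL; closes NOTHING.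
[cite: Jetchev2008, Cor. 1.5 (p. 812)] [cite: MatarNekovar2019, Thm. 0.7] [cite: GrossLMS1991, Prop. 3.7 (2)] [cite: Kato2004Asterisque, Thm. 14.5 (3)] -/
theorem wildUpperNonsurjTower_of_fourNamedFacts
    (hS1 : MatarNekovar2019.thm07_padicValNat_card_sha_primary_add_le_of_globalDivisibility_of_irreducible)
    (h37 : GrossLMS1991.prop37_2_frobeniusCongruence)
    (hPT : ∀ (K : Type) [Field K] [NumberField K], poitouTate_selmerStructure_duality_conj K)
    (hF1 : Gross1991_heegnerPoint_sub_ratTorsion_mem_E0_imageFree)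
    (hH : PublishedInputsHeegner) (hC₄ : PublishedInputCasselsIsogenyRed) (hCS : WildCoatesSujathaResidue)
    (h₂ : WildLowerHalfRankZero) (hR : WildRankOne) (hK : KatoTamagawaExactInputs) (hF : PublishedInputsFineSelmerCM) :
    WildUpperNonsurjTower :=
  WildUpperOptimalSharpNodesJ08S2b.wildUpperNonsurjTower_of_jetchev08TwoSplit_of_boundAtPTwoSplit_of_cruxAResidue
    (cor15_irreducibleReadingTwoSplit_of_namedFacts hS1 h37 hPT hF1 hH.2.1 hH.2.2.2.1)
    (wildJetchevBoundAtPTwoSplit_of_namedFacts hS1 h37 hPT hF1 hH) hH.1 hH.2.1 hH.2.2.1 hH.2.2.2.1 hH.2.2.2.2 hC₄ hCS h₂ hR hK hF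

/-- **The K9 U₀ parent `WildUpperDefectRankZero` (item 19197 — this seat's item) BY NAME with NO Heegner crux**: the previous theorem
composed with the CLOSED glue of the U₀ split (`wildUpperDefectOfSplit_proof`, item 19192), the reducible branch `WildUpperReducibleDefect`
(19190) displayed as a hypothesis. CONDITIONAL on the four named facts and the displayed route items; closes NOTHING; BSD is not proved for any curve.
[cite: Kato2004Asterisque, Thm. 14.5 (3), Prop. 14.16 (2)] [cite: Jetchev2008, Cor. 1.5 (p. 812)] [cite: MatarNekovar2019, Thm. 0.7] -/
theorem wildUpperDefectRankZero_of_fourNamedFacts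
    (hS1 : MatarNekovar2019.thm07_padicValNat_card_sha_primary_add_le_of_globalDivisibility_of_irreducible)
    (h37 : GrossLMS1991.prop37_2_frobeniusCongruence)
    (hPT : ∀ (K : Type) [Field K] [NumberField K], poitouTate_selmerStructure_duality_conj K)
    (hF1 : Gross1991_heegnerPoint_sub_ratTorsion_mem_E0_imageFree)
    (hH : PublishedInputsHeegner) (hC₄ : PublishedInputCasselsIsogenyRed) (hCS : WildCoatesSujathaResidue)
    (h₂ : WildLowerHalfRankZero) (hR : WildRankOne) (hK : KatoTamagawaExactInputs) (hF : PublishedInputsFineSelmerCM)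
    (h₄b : WildUpperReducibleDefect) :
    WildUpperDefectRankZero :=
  wildUpperDefectOfSplit_proof (wildUpperNonsurjTower_of_fourNamedFacts hS1 h37 hPT hF1 hH hC₄ hCS h₂ hR hK hF) h₄b hK

end Summit.BirchSwinnertonDyer.BirchSwinnertonDyer.Theorems.JetchevIrreducibleSwapAtP

end
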